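import Mathlib.Combinatorics.SetFamily.FourFunctions
import Mathlib.Order.Preorder.Finite
import Mathlib.Tactic
import HarnessLib
import HarnessLib.Audit.Tags
import Summits.CriticalPhenomena.PercolationContinuityZ3.Theorems.PercNearOneGluingNoHeavyLowerTailSahiColouredDaykin
import Summits.CriticalPhenomena.PercolationContinuityZ3.Theorems.PercNearOneGluingNoHeavyLowerTailSahiColouredDaykinCross

/-!
# Crossing signed coloured Daykin: the typed Brualdi–Ryser machinery (definitions)

Support file (seat `prim-masterthm-p1`, gen 32; `--supports stmt-CriticalPhenomena-4575`).  Definitions and bookkeeping lemmas for the typed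
Brualdi–Ryser induction (`…SahiColouredDaykinBrualdiStep` proves the step, the induction and its corollaries); no `sorry`, standard axioms.  Memo
`run/shared/lean/prim/prim-masterthm/FROM-prim-masterthm-p1-g32-TYPED-BRUALDI.md`.

SETTING.  `P ⊆ 2^F` three-coloured and CROSSING (any two members meet and do not cover `F`; members of different colours incomparable), as in
`CrossSignedColouredDaykin3` (`…SahiColouredDaykinCross`); bundled as `IsCrossing`.  The complements of the compatible unions are the ADMISSIBLE DIFFERENCES
`admDiffs F P c = {S \ T : same colour} ∪ {S ∩ T : different colours} ∪ {F \ (S ∪ T) : different colours}` (`card_admDiffs_le_card_compatJoins`), so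
`CrossSignedColouredDaykin3` asks for `#P ≤ #admDiffs`.  The ADMISSIBLE INTERSECTIONS are `admInters F P c = {S ∩ T : same colour, S ≠ T} ∪ {F \ (S ∪ T) :
same colour, S ≠ T} ∪ {S \ T : different colours}` (all non-empty, `nonempty_of_mem_admInters`).
THE BRUALDI SET.  For an admissible intersection `E`, `brualdiSet F P c E` is the set of members `p` such that `p` (if `p ⊇ E`) or `F \ p` (if `F \ p ⊇ E`) meets an
ADMISSIBLE partner exactly in `E` (`PosPartner` / `NegPartner`); such a `p` owns the CANDIDATE `cand F E p` (`p \ E` resp. `(F \ p) \ E`), an admissible difference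
(`cand_mem_admDiffs`), and `cand` is injective on the Brualdi set (`cand_injOn`).  This is Brualdi–Ryser's set `C₃` of their induction-on-`m` proof of the
Marica–Schönheim inequality [Brualdi–Ryser, *Combinatorial Matrix Theory* (1991), Thm 9.3.3], for typed (three-colour) differences. [this work]
`Dangerous F P c E` is the rigid RAINBOW-TRIPLE structure through which alone a candidate can fail to be private (proved in `…BrualdiStep`), and `LFCrude` is the
typed conjecture "some inclusion-minimal admissible intersection is not dangerous" (census-clean on every configuration tested, memo §3), which `…BrualdiStep`
shows to imply `CrossSignedColouredDaykin3`.  HONEST FRAMING: definitions, bookkeeping, one typed conjecture. [this work]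
-/

namespace Summit.CriticalPhenomena.PercolationContinuityZ3.Theorems.SahiColouredDaykin

open Finset
open scoped FinsetFamily

variable {α : Type*} [DecidableEq α]

/-! ### 1. Admissible differences and intersections -/

/-- Ordered pairs of members of the same colour. [this work] -/
def samePairs (P : Finset (Finset α)) (c : Finset α → Fin 3) : Finset (Finset α × Finset α) :=
  (P ×ˢ P).filter fun pq => c pq.1 = c pq.2

/-- Ordered pairs of members of different colours. [this work] -/
def crossPairs (P : Finset (Finset α)) (c : Finset α → Fin 3) : Finset (Finset α × Finset α) :=
  (P ×ˢ P).filter fun pq => c pq.1 ≠ c pq.2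

/-- **Admissible differences**: within-colour differences, cross-colour meets, complements of cross-colour joins — the complements of the
compatible unions `compatJoins`. [this work] -/
def admDiffs (F : Finset α) (P : Finset (Finset α)) (c : Finset α → Fin 3) : Finset (Finset α) :=
  ((samePairs P c).image fun pq => pq.1 \ pq.2) ∪
    (((crossPairs P c).image fun pq => pq.1 ∩ pq.2) ∪ ((crossPairs P c).image fun pq => F \ (pq.1 ∪ pq.2)))

/-- **Admissible intersections**: within-colour meets and complemented joins of DISTINCT members, cross-colour differences. [this work] -/
def admInters (F : Finset α) (P : Finset (Finset α)) (c : Finset α → Fin 3) : Finset (Finset α) :=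
  (((samePairs P c).filter fun pq => pq.1 ≠ pq.2).image fun pq => pq.1 ∩ pq.2) ∪
    ((((samePairs P c).filter fun pq => pq.1 ≠ pq.2).image fun pq => F \ (pq.1 ∪ pq.2)) ∪
      ((crossPairs P c).image fun pq => pq.1 \ pq.2))

section membership
variable {F : Finset α} {P : Finset (Finset α)} {c : Finset α → Fin 3} {S T : Finset α}

/-- Within-colour differences are admissible differences. [this work] -/
theorem sdiff_mem_admDiffs (hS : S ∈ P) (hT : T ∈ P) (hc : c S = c T) : S \ T ∈ admDiffs F P c :=
  mem_union.2 (Or.inl (mem_image.2 ⟨(S, T), mem_filter.2 ⟨mem_product.2 ⟨hS, hT⟩, hc⟩, rfl⟩))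

/-- Cross-colour meets are admissible differences. [this work] -/
theorem inter_mem_admDiffs (hS : S ∈ P) (hT : T ∈ P) (hc : c S ≠ c T) : S ∩ T ∈ admDiffs F P c :=
  mem_union.2 (Or.inr (mem_union.2 (Or.inl (mem_image.2 ⟨(S, T), mem_filter.2 ⟨mem_product.2 ⟨hS, hT⟩, hc⟩, rfl⟩))))

/-- Complemented cross-colour joins are admissible differences. [this work] -/
theorem sdiff_union_mem_admDiffs (hS : S ∈ P) (hT : T ∈ P) (hc : c S ≠ c T) : F \ (S ∪ T) ∈ admDiffs F P c :=
  mem_union.2 (Or.inr (mem_union.2 (Or.inr (mem_image.2 ⟨(S, T), mem_filter.2 ⟨mem_product.2 ⟨hS, hT⟩, hc⟩, rfl⟩))))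

/-- Unpacking membership in `admDiffs`. [this work] -/
theorem mem_admDiffs_iff {Z : Finset α} : Z ∈ admDiffs F P c ↔
    (∃ S ∈ P, ∃ T ∈ P, c S = c T ∧ Z = S \ T) ∨ (∃ S ∈ P, ∃ T ∈ P, c S ≠ c T ∧ Z = S ∩ T) ∨
      (∃ S ∈ P, ∃ T ∈ P, c S ≠ c T ∧ Z = F \ (S ∪ T)) := by
  unfold admDiffs samePairs crossPairs
  simp only [mem_union, mem_image, mem_filter, mem_product, Prod.exists]
  constructor
  · rintro (⟨S, T, ⟨⟨hS, hT⟩, hc⟩, rfl⟩ | ⟨S, T, ⟨⟨hS, hT⟩, hc⟩, rfl⟩ | ⟨S, T, ⟨⟨hS, hT⟩, hc⟩, rfl⟩)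
    · exact Or.inl ⟨S, hS, T, hT, hc, rfl⟩
    · exact Or.inr (Or.inl ⟨S, hS, T, hT, hc, rfl⟩)
    · exact Or.inr (Or.inr ⟨S, hS, T, hT, hc, rfl⟩)
  · rintro (⟨S, hS, T, hT, hc, rfl⟩ | ⟨S, hS, T, hT, hc, rfl⟩ | ⟨S, hS, T, hT, hc, rfl⟩)
    · exact Or.inl ⟨S, T, ⟨⟨hS, hT⟩, hc⟩, rfl⟩
    · exact Or.inr (Or.inl ⟨S, T, ⟨⟨hS, hT⟩, hc⟩, rfl⟩)
    · exact Or.inr (Or.inr ⟨S, T, ⟨⟨hS, hT⟩, hc⟩, rfl⟩)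

/-- Within-colour meets of distinct members are admissible intersections. [this work] -/
theorem inter_mem_admInters (hS : S ∈ P) (hT : T ∈ P) (hc : c S = c T) (hne : S ≠ T) : S ∩ T ∈ admInters F P c :=
  mem_union.2 (Or.inl (mem_image.2 ⟨(S, T), mem_filter.2 ⟨mem_filter.2 ⟨mem_product.2 ⟨hS, hT⟩, hc⟩, hne⟩, rfl⟩))

/-- Within-colour complemented joins of distinct members are admissible intersections. [this work] -/
theorem sdiff_union_mem_admInters (hS : S ∈ P) (hT : T ∈ P) (hc : c S = c T) (hne : S ≠ T) : F \ (S ∪ T) ∈ admInters F P c :=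
  mem_union.2 (Or.inr (mem_union.2 (Or.inl
    (mem_image.2 ⟨(S, T), mem_filter.2 ⟨mem_filter.2 ⟨mem_product.2 ⟨hS, hT⟩, hc⟩, hne⟩, rfl⟩))))

/-- Cross-colour differences are admissible intersections. [this work] -/
theorem sdiff_mem_admInters (hS : S ∈ P) (hT : T ∈ P) (hc : c S ≠ c T) : S \ T ∈ admInters F P c :=
  mem_union.2 (Or.inr (mem_union.2 (Or.inr (mem_image.2 ⟨(S, T), mem_filter.2 ⟨mem_product.2 ⟨hS, hT⟩, hc⟩, rfl⟩))))

/-- `admDiffs` is monotone in the configuration. [this work] -/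
theorem admDiffs_mono {P' : Finset (Finset α)} (h : P' ⊆ P) : admDiffs F P' c ⊆ admDiffs F P c := by
  intro Z hZ
  rcases mem_admDiffs_iff.1 hZ with ⟨S, hS, T, hT, hc, rfl⟩ | ⟨S, hS, T, hT, hc, rfl⟩ | ⟨S, hS, T, hT, hc, rfl⟩
  · exact sdiff_mem_admDiffs (h hS) (h hT) hc
  · exact inter_mem_admDiffs (h hS) (h hT) hc
  · exact sdiff_union_mem_admDiffs (h hS) (h hT) hc

/-- Every admissible difference lies inside `F` and has its complement among the compatible unions. [this work] -/
theorem compl_mem_compatJoins_of_mem_admDiffs (hPF : ∀ S ∈ P, S ⊆ F) {Z : Finset α} (hZ : Z ∈ admDiffs F P c) :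
    Z ⊆ F ∧ F \ Z ∈ compatJoins F P c := by
  rcases mem_admDiffs_iff.1 hZ with ⟨S, hS, T, hT, hc, rfl⟩ | ⟨S, hS, T, hT, hc, rfl⟩ | ⟨S, hS, T, hT, hc, rfl⟩
  · refine ⟨sdiff_subset.trans (hPF S hS), ?_⟩
    have e : F \ (S \ T) = T ∪ (F \ S) := by
      ext x
      have h1 : x ∈ T → x ∈ F := fun h => hPF T hT h
      simp only [mem_sdiff, mem_union]
      tauto
    rw [e]; exact union_sdiff_mem_compatJoins hT hS (by rw [hc])
  · refine ⟨inter_subset_left.trans (hPF S hS), ?_⟩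
    have e : F \ (S ∩ T) = (F \ S) ∪ (F \ T) := by
      ext x; simp only [mem_sdiff, mem_inter, mem_union]; tauto
    rw [e]; exact sdiff_union_sdiff_mem_compatJoins hS hT hc
  · refine ⟨sdiff_subset, ?_⟩
    have e : F \ (F \ (S ∪ T)) = S ∪ T :=
      Finset.sdiff_sdiff_eq_self (union_subset (hPF S hS) (hPF T hT))
    rw [e]; exact union_mem_compatJoins hS hT hc

/-- Hence `#admDiffs ≤ #compatJoins` (complementation inside `F` is injective). [this work] -/
theorem card_admDiffs_le_card_compatJoins (hPF : ∀ S ∈ P, S ⊆ F) : #(admDiffs F P c) ≤ #(compatJoins F P c) := by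
  refine Finset.card_le_card_of_injOn (fun Z => F \ Z) (fun Z hZ => (compl_mem_compatJoins_of_mem_admDiffs hPF hZ).2) ?_
  intro Z hZ Z' hZ' h
  have hZF := (compl_mem_compatJoins_of_mem_admDiffs hPF (mem_coe.1 hZ)).1
  have hZ'F := (compl_mem_compatJoins_of_mem_admDiffs hPF (mem_coe.1 hZ')).1
  have : F \ (F \ Z) = F \ (F \ Z') := by
    show F \ ((fun Z => F \ Z) Z) = F \ ((fun Z => F \ Z) Z')
    rw [h]
  rwa [Finset.sdiff_sdiff_eq_self hZF, Finset.sdiff_sdiff_eq_self hZ'F] at this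

end membership
/-! ### 2. Crossing configurations, the Brualdi set, candidates -/

/-- The crossing hypotheses of `CrossSignedColouredDaykin3`, bundled. [this work] -/
structure IsCrossing (F : Finset α) (P : Finset (Finset α)) (c : Finset α → Fin 3) : Prop where
  subset : ∀ S ∈ P, S ⊆ F
  incomp : ∀ S ∈ P, ∀ T ∈ P, c S ≠ c T → ¬ S ⊆ T
  cross : ∀ S ∈ P, ∀ T ∈ P, (S ∩ T).Nonempty ∧ S ∪ T ≠ F

/-- Crossing is hereditary. [this work] -/
theorem IsCrossing.mono {F : Finset α} {P P' : Finset (Finset α)} {c : Finset α → Fin 3} (h : IsCrossing F P c) (hP' : P' ⊆ P) :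
    IsCrossing F P' c :=
  ⟨fun S hS => h.subset S (hP' hS), fun S hS T hT => h.incomp S (hP' hS) T (hP' hT), fun S hS T hT => h.cross S (hP' hS) T (hP' hT)⟩

section step
variable {F : Finset α} {P : Finset (Finset α)} {c : Finset α → Fin 3} {E : Finset α}

/-- In a crossing configuration every admissible intersection is non-empty. [this work] -/
theorem nonempty_of_mem_admInters (hP : IsCrossing F P c) (hE : E ∈ admInters F P c) : E.Nonempty := by
  unfold admInters samePairs crossPairs at hE
  simp only [mem_union, mem_image, mem_filter, mem_product, Prod.exists] at hE
  rcases hE with ⟨S, T, ⟨⟨⟨hS, hT⟩, _⟩, _⟩, rfl⟩ | ⟨S, T, ⟨⟨⟨hS, hT⟩, _⟩, _⟩, rfl⟩ | ⟨S, T, ⟨⟨hS, hT⟩, hc⟩, rfl⟩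
  · exact (hP.cross S hS T hT).1
  · have hne := (hP.cross S hS T hT).2
    have hsub : S ∪ T ⊆ F := union_subset (hP.subset S hS) (hP.subset T hT)
    by_contra h
    rw [not_nonempty_iff_eq_empty, sdiff_eq_empty_iff_subset] at h
    exact hne (Subset.antisymm hsub h)
  · by_contra h
    rw [not_nonempty_iff_eq_empty, sdiff_eq_empty_iff_subset] at h
    exact hP.incomp S hS T hT hc h

/-- `p ⊇ E` has an admissible partner meeting it exactly in `E` (same colour: `p ∩ p' = E`; other colour `q`: `p \ q = E`). [this work] -/
def PosPartner (F : Finset α) (P : Finset (Finset α)) (c : Finset α → Fin 3) (E p : Finset α) : Prop :=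
  (∃ p' ∈ P, c p' = c p ∧ p' ≠ p ∧ E ⊆ p' ∧ p ∩ p' = E) ∨ (∃ q ∈ P, c q ≠ c p ∧ E ⊆ F \ q ∧ p \ q = E)

/-- `F \ p ⊇ E` has an admissible partner meeting it exactly in `E` (same colour: `F \ (p ∪ p') = E`; other colour `q`: `q \ p = E`). [this work] -/
def NegPartner (F : Finset α) (P : Finset (Finset α)) (c : Finset α → Fin 3) (E p : Finset α) : Prop :=
  (∃ p' ∈ P, c p' = c p ∧ p' ≠ p ∧ E ⊆ F \ p' ∧ F \ (p ∪ p') = E) ∨ (∃ q ∈ P, c q ≠ c p ∧ E ⊆ q ∧ q \ p = E)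

/-- `PosPartner` is decidable (bounded quantifiers over `P`). [this work] -/
instance decidablePosPartner (F : Finset α) (P : Finset (Finset α)) (c : Finset α → Fin 3) (E p : Finset α) :
    Decidable (PosPartner F P c E p) := by
  unfold PosPartner; infer_instance

/-- `NegPartner` is decidable (bounded quantifiers over `P`). [this work] -/
instance decidableNegPartner (F : Finset α) (P : Finset (Finset α)) (c : Finset α → Fin 3) (E p : Finset α) :
    Decidable (NegPartner F P c E p) := by
  unfold NegPartner; infer_instance

/-- **The Brualdi set `T(E)`**: members `p` such that `p` (if `p ⊇ E`) or `F \ p` (if `F \ p ⊇ E`) meets an admissible partner exactly in `E`. [this work] -/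
def brualdiSet (F : Finset α) (P : Finset (Finset α)) (c : Finset α → Fin 3) (E : Finset α) : Finset (Finset α) :=
  P.filter fun p => (E ⊆ p ∧ PosPartner F P c E p) ∨ (E ⊆ F \ p ∧ NegPartner F P c E p)

/-- Membership in the Brualdi set. [this work] -/
theorem mem_brualdiSet {p : Finset α} :
    p ∈ brualdiSet F P c E ↔ p ∈ P ∧ ((E ⊆ p ∧ PosPartner F P c E p) ∨ (E ⊆ F \ p ∧ NegPartner F P c E p)) := by
  unfold brualdiSet
  rw [Finset.mem_filter]

/-- The Brualdi set is a sub-configuration. [this work] -/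
theorem brualdiSet_subset : brualdiSet F P c E ⊆ P := fun _ hp => (mem_brualdiSet.1 hp).1

/-- **The candidate** private element of `p ∈ T(E)`. [this work] -/
def cand (F E p : Finset α) : Finset α := if E ⊆ p then p \ E else (F \ p) \ E

/-- Four ways into the Brualdi set (partner `p`).  (1) same colour, positive side. [this work] -/
theorem mem_brualdiSet_pos_same {b p : Finset α} (hb : b ∈ P) (hp : p ∈ P) (hc : c p = c b) (hne : p ≠ b) (hEp : E ⊆ p)
    (h : b ∩ p = E) : b ∈ brualdiSet F P c E :=
  mem_brualdiSet.2 ⟨hb, Or.inl ⟨by rw [← h]; exact inter_subset_left, Or.inl ⟨p, hp, hc, hne, hEp, h⟩⟩⟩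

/-- (2) other colour, positive side: `a \ p = E`. [this work] -/
theorem mem_brualdiSet_pos_cross {a p : Finset α} (ha : a ∈ P) (hp : p ∈ P) (hc : c p ≠ c a) (hEFp : E ⊆ F \ p)
    (h : a \ p = E) : a ∈ brualdiSet F P c E :=
  mem_brualdiSet.2 ⟨ha, Or.inl ⟨by rw [← h]; exact sdiff_subset, Or.inr ⟨p, hp, hc, hEFp, h⟩⟩⟩

/-- (3) same colour, negative side: `F \ (a ∪ p) = E`. [this work] -/
theorem mem_brualdiSet_neg_same {a p : Finset α} (ha : a ∈ P) (hp : p ∈ P) (hc : c p = c a) (hne : p ≠ a) (hEFp : E ⊆ F \ p)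
    (h : F \ (a ∪ p) = E) : a ∈ brualdiSet F P c E := by
  refine mem_brualdiSet.2 ⟨ha, Or.inr ⟨?_, Or.inl ⟨p, hp, hc, hne, hEFp, h⟩⟩⟩
  rw [← h]; exact sdiff_subset_sdiff Subset.rfl subset_union_left

/-- (4) other colour, negative side: `p \ a = E`. [this work] -/
theorem mem_brualdiSet_neg_cross (hP : IsCrossing F P c) {a p : Finset α} (ha : a ∈ P) (hp : p ∈ P) (hc : c p ≠ c a) (hEp : E ⊆ p)
    (h : p \ a = E) : a ∈ brualdiSet F P c E := by
  refine mem_brualdiSet.2 ⟨ha, Or.inr ⟨?_, Or.inr ⟨p, hp, hc, hEp, h⟩⟩⟩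
  rw [← h]; exact sdiff_subset_sdiff (hP.subset p hp) Subset.rfl

/-- **Dangerous** admissible intersections: `E = p ∩ (q ∪ w)` for a covering rainbow triple, or `E = (F \ p) \ (q ∩ w)` for a rainbow triple with empty
intersection (the only configurations through which a candidate can fail to be private, `dangerous_of_cand_mem`). [this work] -/
def Dangerous (F : Finset α) (P : Finset (Finset α)) (c : Finset α → Fin 3) (E : Finset α) : Prop :=
  ∃ p ∈ P, ∃ q ∈ P, ∃ w ∈ P, c p ≠ c q ∧ c p ≠ c w ∧ c q ≠ c w ∧
    ((E ⊆ p ∧ q ∪ w = (F \ p) ∪ E) ∨ (E ⊆ F \ p ∧ q ∩ w = (F \ p) \ E))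

/-- The candidate of a member of the Brualdi set is an admissible difference of `P`. [this work] -/
theorem cand_mem_admDiffs (hP : IsCrossing F P c) {p : Finset α} (hp : p ∈ brualdiSet F P c E) : cand F E p ∈ admDiffs F P c := by
  obtain ⟨hpP, ⟨hEp, hpart⟩ | ⟨hEFp, hpart⟩⟩ := mem_brualdiSet.1 hp
  · have hc : cand F E p = p \ E := by simp [cand, hEp]
    rw [hc]
    rcases hpart with ⟨p', hp', hcol, _, _, h⟩ | ⟨q, hq, hcol, hEq, h⟩
    · have : p \ E = p \ p' := by
        rw [← h]; ext x; simp only [mem_sdiff, mem_inter]; tauto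
      rw [this]; exact sdiff_mem_admDiffs hpP hp' hcol.symm
    · have : p \ E = p ∩ q := by
        rw [← h]; ext x; simp only [mem_sdiff, mem_inter]; tauto
      rw [this]; exact inter_mem_admDiffs hpP hq (Ne.symm hcol)
  · have hEne : ¬ E ⊆ p ∨ E = ∅ := by
      by_cases h : E = ∅
      · exact Or.inr h
      · left; intro h'
        obtain ⟨x, hx⟩ := nonempty_iff_ne_empty.2 h
        exact (mem_sdiff.1 (hEFp hx)).2 (h' hx)
    rcases hEne with hnEp | hE0
    · have hc : cand F E p = (F \ p) \ E := by simp [cand, hnEp]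
      rw [hc]
      rcases hpart with ⟨p', hp', hcol, _, _, h⟩ | ⟨q, hq, hcol, hEq, h⟩
      · have : (F \ p) \ E = p' \ p := by
          rw [← h]; ext x
          have := hP.subset p' hp'
          simp only [mem_sdiff, mem_union]
          constructor
          · rintro ⟨⟨hxF, hxp⟩, hx⟩; exact ⟨by tauto, hxp⟩
          · rintro ⟨hxp', hxp⟩; exact ⟨⟨this hxp', hxp⟩, by tauto⟩
        rw [this]; exact sdiff_mem_admDiffs hp' hpP hcol
      · have : (F \ p) \ E = F \ (p ∪ q) := by
          rw [← h]; ext x; simp only [mem_sdiff, mem_union]; tauto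
        rw [this]; exact sdiff_union_mem_admDiffs hpP hq (Ne.symm hcol)
    · -- degenerate `E = ∅`: the candidate is `p` itself... `cand F ∅ p = p \ ∅ = p`; but then the same-colour partner gives `p ∩ p' = ∅`,
      -- impossible in a crossing configuration, and the cross partner gives `q \ p = ∅`, i.e. `q ⊆ p`, also impossible.
      exfalso
      subst hE0
      rcases hpart with ⟨p', hp', _, _, _, h⟩ | ⟨q, hq, hcol, _, h⟩
      · have hne := (hP.cross p hpP p' hp').2
        have hsub : p ∪ p' ⊆ F := union_subset (hP.subset p hpP) (hP.subset p' hp')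
        rw [sdiff_eq_empty_iff_subset] at h
        exact hne (Subset.antisymm hsub h)
      · rw [sdiff_eq_empty_iff_subset] at h
        exact hP.incomp q hq p hpP hcol h

/-- The candidate map is injective on the Brualdi set. [this work] -/
theorem cand_injOn (hP : IsCrossing F P c) : Set.InjOn (cand F E) ↑(brualdiSet F P c E) := by
  intro p₁ hp₁ p₂ hp₂ h
  have key : ∀ {p : Finset α}, p ∈ brualdiSet F P c E → (E ⊆ p ∧ cand F E p = p \ E) ∨ (¬ E ⊆ p ∧ E ⊆ F \ p ∧ cand F E p = (F \ p) \ E) := by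
    intro p hp
    obtain ⟨hpP, ⟨hEp, _⟩ | ⟨hEFp, hpart⟩⟩ := mem_brualdiSet.1 hp
    · exact Or.inl ⟨hEp, by simp [cand, hEp]⟩
    · by_cases hEp : E ⊆ p
      · exact Or.inl ⟨hEp, by simp [cand, hEp]⟩
      · exact Or.inr ⟨hEp, hEFp, by simp [cand, hEp]⟩
  have hp₁P := brualdiSet_subset (mem_coe.1 hp₁)
  have hp₂P := brualdiSet_subset (mem_coe.1 hp₂)
  rcases key (mem_coe.1 hp₁) with ⟨hE₁, hc₁⟩ | ⟨hnE₁, hEF₁, hc₁⟩ <;>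
    rcases key (mem_coe.1 hp₂) with ⟨hE₂, hc₂⟩ | ⟨hnE₂, hEF₂, hc₂⟩
  · rw [hc₁, hc₂] at h
    calc p₁ = (p₁ \ E) ∪ E := by rw [sdiff_union_of_subset hE₁]
      _ = (p₂ \ E) ∪ E := by rw [h]
      _ = p₂ := sdiff_union_of_subset hE₂
  · exfalso
    rw [hc₁, hc₂] at h
    have e : p₁ = F \ p₂ := by
      calc p₁ = (p₁ \ E) ∪ E := by rw [sdiff_union_of_subset hE₁]
        _ = ((F \ p₂) \ E) ∪ E := by rw [h]
        _ = F \ p₂ := sdiff_union_of_subset hEF₂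
    obtain ⟨x, hx⟩ := (hP.cross p₁ hp₁P p₂ hp₂P).1
    rw [mem_inter, e, mem_sdiff] at hx
    exact hx.1.2 hx.2
  · exfalso
    rw [hc₁, hc₂] at h
    have e : p₂ = F \ p₁ := by
      calc p₂ = (p₂ \ E) ∪ E := by rw [sdiff_union_of_subset hE₂]
        _ = ((F \ p₁) \ E) ∪ E := by rw [h]
        _ = F \ p₁ := sdiff_union_of_subset hEF₁
    obtain ⟨x, hx⟩ := (hP.cross p₂ hp₂P p₁ hp₁P).1
    rw [mem_inter, e, mem_sdiff] at hx
    exact hx.1.2 hx.2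
  · rw [hc₁, hc₂] at h
    have e : F \ p₁ = F \ p₂ := by
      calc F \ p₁ = ((F \ p₁) \ E) ∪ E := by rw [sdiff_union_of_subset hEF₁]
        _ = ((F \ p₂) \ E) ∪ E := by rw [h]
        _ = F \ p₂ := sdiff_union_of_subset hEF₂
    have this : F \ (F \ p₁) = F \ (F \ p₂) := by rw [e]
    rwa [Finset.sdiff_sdiff_eq_self (hP.subset p₁ hp₁P), Finset.sdiff_sdiff_eq_self (hP.subset p₂ hp₂P)] at this

/-- The Brualdi set of an admissible intersection is non-empty (it contains the generating pair). [this work] -/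
theorem brualdiSet_nonempty (hP : IsCrossing F P c) (hEI : E ∈ admInters F P c) : (brualdiSet F P c E).Nonempty := by
  unfold admInters samePairs crossPairs at hEI
  simp only [mem_union, mem_image, mem_filter, mem_product, Prod.exists] at hEI
  rcases hEI with ⟨S, T, ⟨⟨⟨hS, hT⟩, hc⟩, hne⟩, rfl⟩ | ⟨S, T, ⟨⟨⟨hS, hT⟩, hc⟩, hne⟩, rfl⟩ | ⟨S, T, ⟨⟨hS, hT⟩, hc⟩, rfl⟩
  · exact ⟨S, mem_brualdiSet_pos_same hS hT hc.symm (Ne.symm hne) inter_subset_right rfl⟩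
  · refine ⟨S, mem_brualdiSet_neg_same hS hT hc.symm (Ne.symm hne) ?_ rfl⟩
    exact sdiff_subset_sdiff Subset.rfl subset_union_right
  · refine ⟨S, mem_brualdiSet_pos_cross hS hT (Ne.symm hc) ?_ rfl⟩
    exact sdiff_subset_sdiff (hP.subset S hS) Subset.rfl

/-- A crossing configuration with two members has an admissible intersection. [this work] -/
theorem admInters_nonempty (h2 : 2 ≤ #P) : (admInters F P c).Nonempty := by
  obtain ⟨S, hS, T, hT, hne⟩ := Finset.one_lt_card.1 h2
  by_cases hc : c S = c T
  · exact ⟨S ∩ T, inter_mem_admInters hS hT hc hne⟩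
  · exact ⟨S \ T, sdiff_mem_admInters hS hT hc⟩

/-- Three pairwise distinct elements of `Fin 3` cover it. [folklore] -/
private theorem fin3_of_ne (i x y z : Fin 3) : x ≠ y → x ≠ z → y ≠ z → x ≠ i → y ≠ i → z ≠ i → False := by
  revert i x y z; decide

/-- With at most two colours present no admissible intersection is dangerous. [this work] -/
theorem not_dangerous_of_missing_colour {P : Finset (Finset α)} {E : Finset α} (i : Fin 3) (hi : ∀ p ∈ P, c p ≠ i) :
    ¬ Dangerous F P c E := by
  rintro ⟨p, hp, q, hq, w, hw, hpq, hpw, hqw, _⟩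
  exact fin3_of_ne i (c p) (c q) (c w) hpq hpw hqw (hi p hp) (hi q hq) (hi w hw)

/-- Existence of an inclusion-minimal admissible intersection. [this work] -/
theorem exists_minimal_admInters {P : Finset (Finset α)} (h2 : 2 ≤ #P) :
    ∃ E ∈ admInters F P c, ∀ G ∈ admInters F P c, G ⊆ E → G = E := by
  obtain ⟨E, hE⟩ := Finset.exists_minimal (admInters_nonempty (F := F) (c := c) h2)
  exact ⟨E, hE.1, fun G hG hGE => Subset.antisymm hGE (hE.2 hG hGE)⟩

/-- **CONJECTURE LF-crude (typed).**  Every crossing three-colour configuration in which all three colours occur has an inclusion-minimal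
admissible intersection that is not dangerous.  Verified on all 1 720 crossing three-colour configurations of `2^5` and on ≈ 9 000 larger ones (random
`2^6`–`2^{10}`, imbalanced, product-structured, block families; memo §3). [this work] [status: open] -/
@[conjecture] def LFCrude (α : Type*) [DecidableEq α] : Prop :=
  ∀ (F : Finset α) (P : Finset (Finset α)) (c : Finset α → Fin 3),
    (∀ S ∈ P, S ⊆ F) → (∀ S ∈ P, ∀ T ∈ P, c S ≠ c T → ¬ S ⊆ T) → (∀ S ∈ P, ∀ T ∈ P, (S ∩ T).Nonempty ∧ S ∪ T ≠ F) →
    (∀ i : Fin 3, ∃ p ∈ P, c p = i) →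
    ∃ E ∈ admInters F P c, (∀ G ∈ admInters F P c, G ⊆ E → G = E) ∧ ¬ Dangerous F P c E

end step

end Summit.CriticalPhenomena.PercolationContinuityZ3.Theorems.SahiColouredDaykin
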